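import Mathlib
import HarnessLib
import Summits.Ventures.LatticeQCDFlow.Exactness.SUNJitteredLeapfrogHMC
import Summits.Ventures.LatticeQCDFlow.Exactness.JitteredHMCReversible

/-!
# Detailed balance of the jittered leapfrog HMC on `SU(N)^links` and of the engine's jittered `SU(N)` HMC as run

HONEST FRAMING: exact (Metropolis-corrected) sampling algorithms for lattice gauge theory;
figures of merit are autocorrelation/cost numbers at stated couplings and volumes; no
continuum-physics claim.

Venture `LatticeQCDFlow` (cell pub-lqcd), topic `Exactness`, FANOUT row 9 (eng-latcore, the engine's
`hmc_sweep(..., tau_jitter)` on `SU(N)`).  NEW WORK of the cell over the tree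
(`JitteredHMCReversible.jitterHMC_isReversible`: the jittered refresh–propose–accept update satisfies detailed
balance for every jitter law; `SUNJitteredLeapfrogHMC.sunJitterHMCN`: the jittered `n`-step leapfrog HMC in
the engine's coordinates, its involutive volume-preserving proposals; `SUNLeapfrogHMCWilson` /
`SUNWilsonForceLaw`: the Wilson specialisation; row 14's `isReversible_smul`).  Split off
`SUNJitteredHMCExactStep.lean` (whose §1–§2 do not need `JitteredHMCReversible`).  Nothing is cited as a
fact; no number is claimed.

* **`sunJitterHMCN_isReversible`** — the jittered leapfrog HMC on `SU(N)^links` is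
  `e^{−S}·Haar^{⊗links}`-reversible for every jitter law `η`, every step / step-number assignment, every
  measurable increments, action and kinetic term.
* **`wilson_sunWilsonForceJitterHMC_isReversible`** — THE ENGINE'S JITTERED `SU(N)` HMC AS RUN (torus
  `(ℤ/L)^d`, action `(β/N)·S_W`, the engine's momenta / kinetic term / Wilson force law / Metropolis test)
  satisfies detailed balance with respect to `wilsonMeasure (β/N)` for EVERY step-number assignment,
  trajectory-length assignment and jitter law — the hypothesis of the cell's reversible-chain
  autocorrelation theorems.

NOT CLAIMED: anything quantitative; floating point.
-/

noncomputable section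

namespace Summit.Ventures.LatticeQCDFlow.Exactness

open MeasureTheory ProbabilityTheory ProbabilityTheory.Kernel Set Function
open Literature.MathematicalPhysics.QuantumFieldTheory
open Literature.MathematicalPhysics.QuantumLattice (fundamentalRep)
open scoped ENNReal Matrix NNReal

set_option backward.isDefEq.respectTransparency false

/-! ## §1 Detailed balance: the jittered leapfrog HMC on `SU(N)^links` and the engine's kernel as run -/

section ReversibleGeneral

variable {n : Type*} [Fintype n] [DecidableEq n]
variable {E : Type*} [NormedAddCommGroup E] [NormedSpace ℝ E] [MeasurableSpace E] [BorelSpace E]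
  [FiniteDimensional ℝ E]
variable (ι : E →ₗ[ℝ] Matrix n n ℂ) (hι : ∀ a, (ι a)ᴴ = -ι a ∧ (ι a).trace = 0)
variable {L : Type*} [Fintype L] (μ : Measure E) {T : (L → E) → ℝ}
variable {Lab : Type*} [Countable Lab] [MeasurableSpace Lab] [MeasurableSingletonClass Lab]
variable {ε : Lab → ℝ} {g : Lab → (L → Matrix.specialUnitaryGroup n ℂ) → L → E}
  (hg : ∀ l, Measurable (g l)) {S : (L → Matrix.specialUnitaryGroup n ℂ) → ℝ} {N : Lab → ℕ} {η : Measure Lab}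

/-- **THE JITTERED LEAPFROG HMC ON `SU(N)^links` IS `e^{−S}·Haar^{⊗links}`-REVERSIBLE**, for every jitter law
`η`, every step / step-number assignment, every measurable increments, action and kinetic term. -/
theorem sunJitterHMCN_isReversible [μ.IsAddHaarMeasure] [IsProbabilityMeasure η] (hT : Measurable T)
    (hS : Measurable S) :
    IsReversible (sunJitterHMCN ι hι μ T ε hg S N η)
      ((Measure.pi fun _ : L => haarProbability (Matrix.specialUnitaryGroup n ℂ)).withDensity
        fun u => ENNReal.ofReal (Real.exp (-S u))) :=
  jitterHMC_isReversible (vol := Measure.pi fun _ : L => haarProbability (Matrix.specialUnitaryGroup n ℂ))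
    (volP := Measure.pi fun _ : L => μ) η hS hT (fun l => involutive_sunLeapfrogProposalN ι hι (ε l) (g l) (N l))
    (fun l => measurePreserving_sunLeapfrogProposalN ι hι (ε l) (N l) μ (hg l))

end ReversibleGeneral

section ReversibleWilson

variable (N : ℕ) {d L : ℕ} [NeZero L]
variable {Lab : Type*} [Countable Lab] [MeasurableSpace Lab] [MeasurableSingletonClass Lab]

/-- **THE ENGINE'S JITTERED `SU(N)` HMC AS RUN SATISFIES DETAILED BALANCE WITH RESPECT TO THE WILSON MEASURE**
— torus `(ℤ/L)^d`, action `(β/N)·S_W`, the engine's momenta / kinetic term / Wilson force law / Metropolis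
test, for EVERY step-number assignment `nstep`, trajectory-length assignment `τ` and jitter law `η`. -/
theorem wilson_sunWilsonForceJitterHMC_isReversible (β : ℝ) (nstep : Lab → ℕ) (τ : Lab → ℝ) (η : Measure Lab)
    [IsProbabilityMeasure η] :
    IsReversible
      (sunJitterHMCN (sunCoordι N) (sunCoordι_skew N) (Measure.addHaar : Measure (SUNCoords N)) (sunKinetic N)
        (fun l => τ l / nstep l)
        (fun l => measurable_halfKick_sun N (measurable_sunWilsonForceLaw_coeConfig N (d := d) (L := L) β) (τ l / nstep l))
        (fun U => β / N * wilsonAction (fundamentalRep (Fin N)) U) nstep η)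
      (wilsonMeasure (d := d) (L := L) (fundamentalRep (Fin N)) (β / N)) := by
  rw [← gibbsProbability_smul_wilsonAction_eq N (d := d) (L := L) (fundamentalRep (Fin N)) (β / N), gibbsProbability]
  exact isReversible_smul (sunJitterHMCN_isReversible (sunCoordι N) (sunCoordι_skew N) Measure.addHaar _
    (measurable_sunKinetic N) (measurable_engineWilsonAction N β)) _

end ReversibleWilson

end Summit.Ventures.LatticeQCDFlow.Exactness
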